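import Summits.Parity.GeneralizedHardyLittlewood.Theorems.PrimeLevelFamEdgeMomentsBeyondDiagonalDiagRemTwoTwoDeltaSub
import Summits.Parity.GeneralizedHardyLittlewood.Theorems.PrimeLevelFamEdgeMomentsBeyondDiagonalDiagRemTwoTwoBoseZero
import Summits.Parity.GeneralizedHardyLittlewood.Theorems.PrimeLevelFamEdgeMomentsBeyondDiagonalDiagRemP2TailHolds
import Summits.Parity.GeneralizedHardyLittlewood.Theorems.PrimeLevelFamEdgeMomentsBeyondDiagonalDiagRemInner
import Literature.NumberTheory.Sieve.BombieriVinogradovReduction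
import HarnessLib

/-!
# Route `PrimeLevelFamEdge`, crux K_A `MomentsBeyondDiagonal` (stmt-Parity-20007), line «petersson_layers» v4, stub `stub_diag`:
# **column data of the order-`(2,2)` remainder estimate (R₂₂): the `3P₂²−2P₄`-decorated column and the both-sided
# `P₂ ⊗ P₂ · r₀₀` monomial with a BUDGET-SHARP envelope** (brick B4a)

Brick B4a of (R₂₂) (the hypothesis `hR₂₂` of `…DiagRungTwoOfR22.diagPart_asymp_of_natDegree_le_two_of_remainder`, p830190).
The order-`(2,2)` weight (`…DiagDecorOrderRungTwoHecke.heckeSum_orderTwoTwo_eq`) has, besides the `P₂`-decorated columns of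
order `(1,1)`/`(0,2)` (`…DiagRemInner`), the one-sided decoration `3P₂(k)² − 2P₄(k)` (`P_m(k) = Σ_{p∣k} log^m p`; from
`(3S₂² − 2S₄)/16`) and the both-sided monomial `P₂(k₁)P₂(k₂)·r₀₀`. This file supplies

* `sum_primeFactors_log_pow_le` — `Σ_{p∣k} log^m p ≤ log^m k` (`m ≥ 1`; from `Literature.NumberTheory.Sieve.sum_primeFactors_log_le`);
* `abs_decorFour_le` — `|3P₂(k)² − 2P₄(k)| ≤ 5 log⁴k`;
* `sum_tau_div_decorFour_ellp_pow_le`, `abs_sum_copTauW_decorFour_le`, `sum_abs_copTauW_decorFour_ellp_pow_le` — the trivial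
  bounds of the `3P₂²−2P₄`-decorated column (`≤ 5·logᵐY·(1+log Y)⁶`);
* `abs_bothsided_primeSq_rem00_le₂` — **`∃ E₀₀ C₀ C_P ≥ 0`: (i) the two-sequence estimate for `r₀₀`; (ii) the both-sided bound
  `|Σ a_nP₂ ⊗ a_nP₂ ℓ⁺ⁱℓ⁺ʲ r₀₀| ≤ log^{i+j}Y·C₀·[(3W·L₄ + 3C_PD·W + (C_PD)²)√(2αK₁Y) + (18L₄·C_PD + 19(C_PD)²)x⁶/(1+log K₁)¹²]`**,
  `L₄ = (1+log Y)⁴`, `W = L₄ + C_PD`, `x = 1+|log 2αY²|` — the same δ-subtraction as `…DiagRemTwoTwoBothSided` (p830583) but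
  WITHOUT squaring `W`: the log-saving term has size `Λ¹⁰·D + Λ⁶·D²`, inside the budget `Λ¹²` of (R₂₂) (the squared form
  `W²x⁶ ≍ Λ¹⁴` is not).

Def-free; theorems only. Helper `--supports stmt-Parity-20007`; closes nothing; K_A, K_B and the Parity summit are NOT proved;
nothing about Landau–Siegel zeros.

## References
* E. Kowalski, P. Michel, J. VanderKam, J. reine angew. Math. 526 (2000), (22)–(28) pp. 12–15 and Prop. 5.1 p. 18.
  [cite: KowalskiMichelVanderKam2000, Prop. 5.1 — derivation (decorated remainder monomials of order (2,2))]
-/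

noncomputable section

open Real Finset

namespace Summit.Parity.GeneralizedHardyLittlewood.Theorems.MomentsBeyondDiagonal.DiagCorner

open Literature.Barriers.Parity (Icc_one_eq_Ioc_zero)
open Summit.Parity.GeneralizedHardyLittlewood.Theorems.BeyondDiagonalBeatsQuarter.KernelFormXSq
  (copTauW copTauW_apply divWeight divWeight_nonneg abs_W_le)
open Summit.Parity.GeneralizedHardyLittlewood.Theorems.BeyondDiagonalBeatsQuarter.Corner

/-! ### The `3P₂² − 2P₄`-decorated column -/

/-- `Σ_{p∣k} log^m p ≤ log^m k` for `m ≥ 1`, `k ≥ 1` (`log^m p ≤ log p · log^{m−1} k`). [folklore] -/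
theorem sum_primeFactors_log_pow_le {k : ℕ} (hk : k ≠ 0) {m : ℕ} (hm : 1 ≤ m) :
    ∑ p ∈ k.primeFactors, Real.log p ^ m ≤ Real.log k ^ m := by
  have hk1 : (1 : ℝ) ≤ k := by exact_mod_cast Nat.one_le_iff_ne_zero.2 hk
  have hlogk : 0 ≤ Real.log k := Real.log_nonneg hk1
  have hp : ∀ p ∈ k.primeFactors, 0 ≤ Real.log p ∧ Real.log p ≤ Real.log k := by
    intro p hp
    have hp' := (Nat.mem_primeFactors_of_ne_zero hk).1 hp
    have h2 : (2 : ℝ) ≤ p := by exact_mod_cast hp'.1.two_le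
    exact ⟨Real.log_nonneg (by linarith),
      Real.log_le_log (by linarith) (by exact_mod_cast Nat.le_of_dvd (Nat.pos_of_ne_zero hk) hp'.2)⟩
  obtain ⟨m', rfl⟩ : ∃ m', m = m' + 1 := ⟨m - 1, by omega⟩
  calc ∑ p ∈ k.primeFactors, Real.log p ^ (m' + 1) ≤ ∑ p ∈ k.primeFactors, Real.log p * Real.log k ^ m' := by
        refine Finset.sum_le_sum fun p hp' ↦ ?_
        rw [pow_succ, mul_comm]
        exact mul_le_mul_of_nonneg_left (pow_le_pow_left₀ (hp p hp').1 (hp p hp').2 m') (hp p hp').1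
    _ = (∑ p ∈ k.primeFactors, Real.log p) * Real.log k ^ m' := by rw [Finset.sum_mul]
    _ ≤ Real.log k * Real.log k ^ m' := mul_le_mul_of_nonneg_right (Literature.NumberTheory.Sieve.sum_primeFactors_log_le hk) (by positivity)
    _ = Real.log k ^ (m' + 1) := by ring

/-- `|3P₂(k)² − 2P₄(k)| ≤ 5 log⁴k` (`k ≥ 1`). [folklore] -/
theorem abs_decorFour_le {k : ℕ} (hk : k ≠ 0) :
    |3 * (∑ p ∈ k.primeFactors, Real.log p ^ 2) ^ 2 - 2 * ∑ p ∈ k.primeFactors, Real.log p ^ 4| ≤ 5 * Real.log k ^ 4 := by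
  have h2 := sum_primeFactors_log_pow_le hk (show 1 ≤ 2 by norm_num)
  have h4 := sum_primeFactors_log_pow_le hk (show 1 ≤ 4 by norm_num)
  have h20 : 0 ≤ ∑ p ∈ k.primeFactors, Real.log p ^ 2 := Finset.sum_nonneg fun p _ ↦ sq_nonneg _
  have h40 : 0 ≤ ∑ p ∈ k.primeFactors, Real.log p ^ 4 := Finset.sum_nonneg fun p _ ↦ by positivity
  have h22 : (∑ p ∈ k.primeFactors, Real.log p ^ 2) ^ 2 ≤ (Real.log k ^ 2) ^ 2 := pow_le_pow_left₀ h20 h2 2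
  rw [abs_le]
  constructor <;> nlinarith

/-- `Σ_{k≤Y} (τ(k)/k)·|3P₂(k)²−2P₄(k)|·ℓ⁺(k)^m ≤ 5·log^mY·(1+log Y)⁶` (`Y ≥ 1`). [folklore] -/
theorem sum_tau_div_decorFour_ellp_pow_le (m : ℕ) {Y : ℝ} (hY : 1 ≤ Y) :
    ∑ k ∈ Icc 1 ⌊Y⌋₊, (k.divisors.card : ℝ) / k *
        |3 * (∑ p ∈ k.primeFactors, Real.log p ^ 2) ^ 2 - 2 * ∑ p ∈ k.primeFactors, Real.log p ^ 4| * ellp Y k ^ m ≤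
      5 * Real.log Y ^ m * (1 + Real.log Y) ^ 6 := by
  have hY0 : 0 < Y := by linarith
  have hLY : 0 ≤ Real.log Y := Real.log_nonneg hY
  have h1 : ∀ k ∈ Icc 1 ⌊Y⌋₊, (k.divisors.card : ℝ) / k *
      |3 * (∑ p ∈ k.primeFactors, Real.log p ^ 2) ^ 2 - 2 * ∑ p ∈ k.primeFactors, Real.log p ^ 4| * ellp Y k ^ m ≤
      (k.divisors.card : ℝ) / k * (5 * Real.log Y ^ 4 * Real.log Y ^ m) := by
    intro k hk
    have hk1 := (Finset.mem_Icc.1 hk).1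
    have hkY : (k : ℝ) ≤ Y := le_trans (by exact_mod_cast (Finset.mem_Icc.1 hk).2) (Nat.floor_le hY0.le)
    have hk0 : k ≠ 0 := by omega
    have hlogk : Real.log k ≤ Real.log Y := Real.log_le_log (by exact_mod_cast hk1) hkY
    have hlogk0 : 0 ≤ Real.log k := Real.log_nonneg (by exact_mod_cast hk1)
    have hD : |3 * (∑ p ∈ k.primeFactors, Real.log p ^ 2) ^ 2 - 2 * ∑ p ∈ k.primeFactors, Real.log p ^ 4| ≤
        5 * Real.log Y ^ 4 :=
      (abs_decorFour_le hk0).trans (by gcongr)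
    have hl : ellp Y k ^ m ≤ Real.log Y ^ m := pow_le_pow_left₀ (ellp_nonneg Y k) (ellp_le_log hY hk1) m
    rw [mul_assoc]
    refine mul_le_mul_of_nonneg_left ?_ (by positivity)
    exact mul_le_mul hD hl (pow_nonneg (ellp_nonneg Y k) m) (by positivity)
  refine (Finset.sum_le_sum h1).trans ?_
  rw [← Finset.sum_mul]
  have h2 : ∑ k ∈ Icc 1 ⌊Y⌋₊, (k.divisors.card : ℝ) / k ≤ (1 + Real.log ⌊Y⌋₊) ^ 2 := by
    rw [Icc_one_eq_Ioc_zero]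
    exact Literature.NumberTheory.Sieve.Vaughan.sum_card_divisors_div_le ⌊Y⌋₊
  have h3 : (1 + Real.log ⌊Y⌋₊) ^ 2 ≤ (1 + Real.log Y) ^ 2 := by
    have hf1 : (1 : ℝ) ≤ ⌊Y⌋₊ := by exact_mod_cast Nat.le_floor (by simpa using hY)
    have : Real.log (⌊Y⌋₊ : ℝ) ≤ Real.log Y := Real.log_le_log (by linarith) (Nat.floor_le hY0.le)
    have : 0 ≤ Real.log (⌊Y⌋₊ : ℝ) := Real.log_nonneg hf1
    nlinarith
  have h4 : Real.log Y ^ 4 ≤ (1 + Real.log Y) ^ 4 := pow_le_pow_left₀ hLY (by linarith) 4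
  calc (∑ k ∈ Icc 1 ⌊Y⌋₊, (k.divisors.card : ℝ) / k) * (5 * Real.log Y ^ 4 * Real.log Y ^ m)
      ≤ (1 + Real.log Y) ^ 2 * (5 * (1 + Real.log Y) ^ 4 * Real.log Y ^ m) := by
        refine mul_le_mul (h2.trans h3) ?_ (by positivity) (by positivity)
        exact mul_le_mul_of_nonneg_right (by linarith) (pow_nonneg hLY m)
    _ = 5 * Real.log Y ^ m * (1 + Real.log Y) ^ 6 := by ring

/-- Partial sums of the `3P₂²−2P₄`-decorated column: `|Σ_{k≤e} a_n(k)(3P₂(k)²−2P₄(k))| ≤ 5(1+log Y)⁶` for `e ≤ ⌊Y⌋`.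
[folklore] -/
theorem abs_sum_copTauW_decorFour_le (n : ℕ) {Y : ℝ} (hY : 1 ≤ Y) {e : ℕ} (he : e ≤ ⌊Y⌋₊) :
    |∑ k ∈ Icc 1 e, copTauW n k *
        (3 * (∑ p ∈ k.primeFactors, Real.log p ^ 2) ^ 2 - 2 * ∑ p ∈ k.primeFactors, Real.log p ^ 4)| ≤
      5 * (1 + Real.log Y) ^ 6 := by
  have h := sum_tau_div_decorFour_ellp_pow_le 0 hY
  simp only [pow_zero, mul_one] at h
  calc _ ≤ ∑ k ∈ Icc 1 e, |copTauW n k *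
          (3 * (∑ p ∈ k.primeFactors, Real.log p ^ 2) ^ 2 - 2 * ∑ p ∈ k.primeFactors, Real.log p ^ 4)| :=
        Finset.abs_sum_le_sum_abs _ _
    _ ≤ ∑ k ∈ Icc 1 ⌊Y⌋₊, |copTauW n k *
          (3 * (∑ p ∈ k.primeFactors, Real.log p ^ 2) ^ 2 - 2 * ∑ p ∈ k.primeFactors, Real.log p ^ 4)| :=
        Finset.sum_le_sum_of_subset_of_nonneg (Finset.Icc_subset_Icc_right he) fun _ _ _ ↦ abs_nonneg _
    _ ≤ ∑ k ∈ Icc 1 ⌊Y⌋₊, (k.divisors.card : ℝ) / k *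
          |3 * (∑ p ∈ k.primeFactors, Real.log p ^ 2) ^ 2 - 2 * ∑ p ∈ k.primeFactors, Real.log p ^ 4| := by
        refine Finset.sum_le_sum fun k _ ↦ ?_
        rw [abs_mul]
        exact mul_le_mul_of_nonneg_right (abs_copTauW_le n k) (abs_nonneg _)
    _ ≤ 5 * (1 + Real.log Y) ^ 6 := by simpa using h

/-- `Σ_{k≤Y} |a_n(k)(3P₂(k)²−2P₄(k))|·ℓ⁺(k)^m ≤ 5·log^mY·(1+log Y)⁶`. [folklore] -/
theorem sum_abs_copTauW_decorFour_ellp_pow_le (n m : ℕ) {Y : ℝ} (hY : 1 ≤ Y) :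
    ∑ k ∈ Icc 1 ⌊Y⌋₊, |copTauW n k *
        (3 * (∑ p ∈ k.primeFactors, Real.log p ^ 2) ^ 2 - 2 * ∑ p ∈ k.primeFactors, Real.log p ^ 4)| * ellp Y k ^ m ≤
      5 * Real.log Y ^ m * (1 + Real.log Y) ^ 6 := by
  refine le_trans (Finset.sum_le_sum fun k _ ↦ ?_) (sum_tau_div_decorFour_ellp_pow_le m hY)
  rw [abs_mul]
  exact mul_le_mul_of_nonneg_right (mul_le_mul_of_nonneg_right (abs_copTauW_le n k) (abs_nonneg _))
    (pow_nonneg (ellp_nonneg Y k) m)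

/-! ### The both-sided monomial, budget-sharp envelope -/

set_option maxHeartbeats 1600000 in
/-- **The both-sided monomial `a_nP₂ ⊗ a_nP₂ · r₀₀`, budget-sharp form** (see the module docstring).
[cite: KowalskiMichelVanderKam2000, Prop. 5.1 — derivation (both-sided decorated remainder monomial, order (2,2))] -/
theorem abs_bothsided_primeSq_rem00_le₂ : ∃ E₀₀ C₀ C_P : ℝ, 0 ≤ C₀ ∧ 0 ≤ C_P ∧
    (∀ (a₁ a₂ : ℕ → ℝ) (Y α B η : ℝ) (K₁ i j : ℕ), 1 ≤ Y → 0 < α → 1 ≤ i → 1 ≤ j →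
      (∀ e : ℕ, e ≤ ⌊Y⌋₊ → |∑ k ∈ Icc 1 e, a₂ k| ≤ B) → (∀ e : ℕ, K₁ ≤ e → |∑ k ∈ Icc 1 e, a₁ k| ≤ η) →
      2 * α * K₁ * Y ≤ 1 →
    |∑ k₁ ∈ Icc 1 ⌊Y⌋₊, ∑ k₂ ∈ Icc 1 ⌊Y⌋₊,
        a₁ k₁ * a₂ k₂ * ellp Y k₁ ^ i * ellp Y k₂ ^ j *
          ((∫ u₁ in Set.Ioi (0 : ℝ), ∫ u₂ in Set.Ioi ((α * k₁ * k₂) / u₁),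
              Real.exp (-(u₁ + u₂)) / (1 - Real.exp (-(u₁ + u₂))) ^ 2) -
            (Real.log (1 / (α * k₁ * k₂)) / 2 + E₀₀))| ≤
      (∑ k ∈ Icc 1 ⌊Y⌋₊, |a₁ k| * ellp Y k ^ i) * (B * (Real.log Y ^ j * (3 * C₀ * Real.sqrt (2 * α * K₁ * Y)))) +
        (∑ k ∈ Icc 1 ⌊Y⌋₊, |a₂ k| * ellp Y k ^ j) *
          ((2 * η) * (Real.log Y ^ i * (9 * C₀ * (1 + |Real.log (2 * α * Y ^ 2)|) ^ 6)))) ∧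
    (∀ n : ℕ, n ≠ 0 → ∀ (Y α : ℝ) (K₁ i j : ℕ), 1 ≤ Y → 0 < α → 1 ≤ i → 1 ≤ j → 2 * α * K₁ * Y ≤ 1 →
    |∑ k₁ ∈ Icc 1 ⌊Y⌋₊, ∑ k₂ ∈ Icc 1 ⌊Y⌋₊,
        (copTauW n k₁ * ∑ p ∈ k₁.primeFactors, Real.log p ^ 2) *
          (copTauW n k₂ * ∑ p ∈ k₂.primeFactors, Real.log p ^ 2) * ellp Y k₁ ^ i * ellp Y k₂ ^ j *
          ((∫ u₁ in Set.Ioi (0 : ℝ), ∫ u₂ in Set.Ioi ((α * k₁ * k₂) / u₁),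
              Real.exp (-(u₁ + u₂)) / (1 - Real.exp (-(u₁ + u₂))) ^ 2) -
            (Real.log (1 / (α * k₁ * k₂)) / 2 + E₀₀))| ≤
      Real.log Y ^ (i + j) * (C₀ *
        ((3 * ((1 + Real.log Y) ^ 4 + C_P * divWeight n) * (1 + Real.log Y) ^ 4 +
            3 * (C_P * divWeight n) * ((1 + Real.log Y) ^ 4 + C_P * divWeight n) + (C_P * divWeight n) ^ 2) *
            Real.sqrt (2 * α * K₁ * Y) +
          (18 * (1 + Real.log Y) ^ 4 * (C_P * divWeight n) + 19 * (C_P * divWeight n) ^ 2) *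
            (1 + |Real.log (2 * α * Y ^ 2)|) ^ 6 / (1 + Real.log K₁) ^ 12))) := by
  obtain ⟨E₀₀, C₀, hC₀, hR2, hRs, hRt⟩ := abs_rem00_twoSeq_and_pointwise
  obtain ⟨C_P, hC_P, hP⟩ := abs_sum_copTauW_primeSq_sub_le
  refine ⟨E₀₀, C₀, C_P, hC₀, hC_P, hR2, fun n hn Y α K₁ i j hY hα hi hj hY₁ ↦ ?_⟩
  obtain ⟨c, hc, hcy⟩ := hP n hn
  set D : ℝ := divWeight n with hDdef
  have hD0 : 0 ≤ D := divWeight_nonneg n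
  have hY0 : 0 < Y := by linarith
  have hLY : 0 ≤ Real.log Y := Real.log_nonneg hY
  set L4 : ℝ := (1 + Real.log Y) ^ 4 with hL4
  have hL41 : 1 ≤ L4 := one_le_pow₀ (by linarith)
  set W : ℝ := L4 + C_P * D with hW
  have hW0 : 0 ≤ W := by positivity
  set x : ℝ := 1 + |Real.log (2 * α * Y ^ 2)| with hx
  have hx1 : 1 ≤ x := by rw [hx]; linarith [abs_nonneg (Real.log (2 * α * Y ^ 2))]
  set T : ℝ := C_P * D / (1 + Real.log K₁) ^ 12 with hT
  have hK0 : 0 ≤ Real.log (K₁ : ℝ) := Real.log_natCast_nonneg K₁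
  have hT0 : 0 ≤ T := by positivity
  have hTle : T ≤ C_P * D := div_le_self (by positivity) (one_le_pow₀ (by linarith))
  set sq : ℝ := Real.sqrt (2 * α * K₁ * Y) with hsq
  have hsq0 : 0 ≤ sq := Real.sqrt_nonneg _
  -- the sequence `b = a_n·P₂` and its data
  set b : ℕ → ℝ := fun k ↦ copTauW n k * ∑ p ∈ k.primeFactors, Real.log p ^ 2 with hb
  have hbt : ∀ e : ℕ, K₁ ≤ e → |∑ k ∈ Icc 1 e, (b k - if k = 1 then c else 0)| ≤ T := by
    intro e he
    rcases Nat.eq_zero_or_pos e with rfl | he0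
    · simp only [show Icc (1 : ℕ) 0 = ∅ from Finset.Icc_eq_empty (by norm_num), Finset.sum_empty, abs_zero]
      exact hT0
    · have h1e : 1 ∈ Icc 1 e := Finset.mem_Icc.2 ⟨le_rfl, he0⟩
      have hsum : ∑ k ∈ Icc 1 e, (b k - if k = 1 then c else 0) = (∑ k ∈ Icc 1 e, b k) - c := by
        rw [Finset.sum_sub_distrib, Finset.sum_ite_eq' (Icc 1 e) 1 (fun _ ↦ c), if_pos h1e]
      rw [hsum]
      have h := hcy (e : ℝ) (by exact_mod_cast he0)
      rw [Nat.floor_natCast] at h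
      refine h.trans ?_
      rw [hT]
      apply div_le_div_of_nonneg_left (by positivity) (by positivity)
      have hle : Real.log (K₁ : ℝ) ≤ Real.log (e : ℝ) := by
        rcases Nat.eq_zero_or_pos K₁ with rfl | hK
        · simp only [Nat.cast_zero, Real.log_zero]; exact Real.log_natCast_nonneg e
        · exact Real.log_le_log (by exact_mod_cast hK) (by exact_mod_cast he)
      exact pow_le_pow_left₀ (by positivity) (by linarith) 12
  have hbcol : ∀ e : ℕ, e ≤ ⌊Y⌋₊ → |∑ k ∈ Icc 1 e, b k| ≤ L4 := fun e he ↦ abs_sum_copTauW_primeSq_le n hY he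
  -- the abstract δ-subtraction
  have hmain := abs_doubleSum_delta_sub_le (R := fun y ↦ (∫ u₁ in Set.Ioi (0 : ℝ), ∫ u₂ in Set.Ioi (y / u₁),
      Real.exp (-(u₁ + u₂)) / (1 - Real.exp (-(u₁ + u₂))) ^ 2) - (Real.log (1 / y) / 2 + E₀₀))
    hR2 b c T L4 hY hα hi hj hY₁ hbt hbcol
  refine hmain.trans ?_
  -- the absolute sums
  have hSb : ∀ m : ℕ, ∑ k ∈ Icc 1 ⌊Y⌋₊, |b k| * ellp Y k ^ m ≤ Real.log Y ^ m * L4 :=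
    fun m ↦ sum_abs_copTauW_primeSq_ellp_pow_le n m hY
  have h1I : 1 ∈ Icc 1 ⌊Y⌋₊ := Finset.mem_Icc.2 ⟨le_rfl, Nat.le_floor (by simpa using hY)⟩
  have hl1 : ellp Y 1 = Real.log Y := by rw [ellp_eq_log hY0.le h1I]; simp
  have hSbt : ∀ m : ℕ, ∑ k ∈ Icc 1 ⌊Y⌋₊, |b k - if k = 1 then c else 0| * ellp Y k ^ m ≤ Real.log Y ^ m * W := by
    intro m
    have hpt : ∀ k ∈ Icc 1 ⌊Y⌋₊, |b k - if k = 1 then c else 0| * ellp Y k ^ m ≤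
        |b k| * ellp Y k ^ m + (if k = 1 then |c| * ellp Y k ^ m else 0) := by
      intro k _
      split_ifs with hk
      · have : |b k - c| ≤ |b k| + |c| := abs_sub _ _
        have h0 : 0 ≤ ellp Y k ^ m := pow_nonneg (ellp_nonneg Y k) m
        nlinarith
      · rw [sub_zero]; linarith
    refine (Finset.sum_le_sum hpt).trans ?_
    rw [Finset.sum_add_distrib, Finset.sum_ite_eq' (Icc 1 ⌊Y⌋₊) 1, if_pos h1I, hl1]
    have := hSb m
    rw [hW]; nlinarith [pow_nonneg hLY m]
  have hSδ : ∑ k ∈ Icc 1 ⌊Y⌋₊, |(if k = 1 then (1 : ℝ) else 0)| * ellp Y k ^ i = Real.log Y ^ i := by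
    rw [Finset.sum_eq_single_of_mem 1 h1I (fun k _ hk ↦ by simp [hk])]
    simp [hl1]
  -- the `δ⊗δ` value
  have hRα : |(∫ u₁ in Set.Ioi (0 : ℝ), ∫ u₂ in Set.Ioi (α / u₁),
      Real.exp (-(u₁ + u₂)) / (1 - Real.exp (-(u₁ + u₂))) ^ 2) - (Real.log (1 / α) / 2 + E₀₀)| ≤
      C₀ * (sq + x ^ 6 / (1 + Real.log K₁) ^ 12) := by
    rcases Nat.eq_zero_or_pos K₁ with hK | hK
    · -- threshold `0`: no constraint on `α`; trivial bound by `C₀·x⁶`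
      have hK' : (K₁ : ℝ) = 0 := by exact_mod_cast hK
      have hden : (1 + Real.log (K₁ : ℝ)) ^ 12 = 1 := by rw [hK', Real.log_zero]; norm_num
      rw [hden, div_one]
      have hx6 : x ≤ x ^ 6 := le_self_pow₀ hx1 (by norm_num)
      rcases le_or_gt α 1 with hα1 | hα1
      · have h := hRs α hα hα1
        have : Real.sqrt α ≤ 1 := Real.sqrt_le_one.mpr hα1 |>.trans_eq' rfl
        calc _ ≤ C₀ * Real.sqrt α := h
          _ ≤ C₀ * 1 := mul_le_mul_of_nonneg_left (Real.sqrt_le_one.2 hα1) hC₀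
          _ ≤ C₀ * (sq + x ^ 6) := by
              apply mul_le_mul_of_nonneg_left _ hC₀; nlinarith
      · have h := hRt α hα1.le
        have hlx : 1 + Real.log α ≤ x := by
          rw [hx]
          have hlog : Real.log (2 * α * Y ^ 2) = Real.log 2 + Real.log α + 2 * Real.log Y := by
            rw [Real.log_mul (by positivity) (by positivity), Real.log_mul (by norm_num) hα.ne', Real.log_pow]
            push_cast; ring
          have hl2 : 0 < Real.log 2 := Real.log_pos (by norm_num)
          have : Real.log α ≤ |Real.log (2 * α * Y ^ 2)| := by
            rw [hlog]; exact le_trans (by linarith) (le_abs_self _)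
          linarith
        calc _ ≤ C₀ * (1 + Real.log α) := h
          _ ≤ C₀ * x := mul_le_mul_of_nonneg_left hlx hC₀
          _ ≤ C₀ * (sq + x ^ 6) := by apply mul_le_mul_of_nonneg_left _ hC₀; linarith
    · -- threshold `K₁ ≥ 1`: `α ≤ 2αK₁Y ≤ 1`, power saving
      have hK1 : (1 : ℝ) ≤ K₁ := by exact_mod_cast hK
      have hαle : α ≤ 2 * α * K₁ * Y := by
        have h2 : (1 : ℝ) ≤ 2 * K₁ * Y := by nlinarith
        have := mul_le_mul_of_nonneg_left h2 hα.le
        linarith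
      have hα1 : α ≤ 1 := hαle.trans hY₁
      have h := hRs α hα hα1
      calc _ ≤ C₀ * Real.sqrt α := h
        _ ≤ C₀ * sq := mul_le_mul_of_nonneg_left (Real.sqrt_le_sqrt hαle) hC₀
        _ ≤ C₀ * (sq + x ^ 6 / (1 + Real.log K₁) ^ 12) := by
            apply mul_le_mul_of_nonneg_left _ hC₀
            have : 0 ≤ x ^ 6 / (1 + Real.log K₁) ^ 12 := by positivity
            linarith
  -- bookkeeping
  have hLi : 0 ≤ Real.log Y ^ i := pow_nonneg hLY i
  have hLj : 0 ≤ Real.log Y ^ j := pow_nonneg hLY j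
  set CD : ℝ := C_P * D with hCD
  have hCD0 : 0 ≤ CD := by positivity
  have hc' : |c| ≤ CD := hc
  have hx6 : 0 ≤ x ^ 6 := by positivity
  have hK12 : 0 < (1 + Real.log (K₁ : ℝ)) ^ 12 := by positivity
  have hP3 : 0 ≤ 3 * C₀ * sq := by positivity
  have hP9 : 0 ≤ 9 * C₀ * x ^ 6 := by positivity
  have hTdef : T = CD / (1 + Real.log K₁) ^ 12 := by rw [hT, hCD]
  have t1 : (∑ k ∈ Icc 1 ⌊Y⌋₊, |b k - if k = 1 then c else 0| * ellp Y k ^ i) *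
      (L4 * (Real.log Y ^ j * (3 * C₀ * sq))) ≤ Real.log Y ^ (i + j) * (C₀ * (3 * W * L4 * sq)) := by
    have hX : 0 ≤ L4 * (Real.log Y ^ j * (3 * C₀ * sq)) := by positivity
    calc _ ≤ (Real.log Y ^ i * W) * (L4 * (Real.log Y ^ j * (3 * C₀ * sq))) :=
          mul_le_mul_of_nonneg_right (hSbt i) hX
      _ = _ := by rw [pow_add]; ring
  have t2 : (∑ k ∈ Icc 1 ⌊Y⌋₊, |b k| * ellp Y k ^ j) * ((2 * T) * (Real.log Y ^ i * (9 * C₀ * x ^ 6))) ≤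
      Real.log Y ^ (i + j) * (C₀ * (18 * L4 * CD * x ^ 6 / (1 + Real.log K₁) ^ 12)) := by
    have hX : 0 ≤ (2 * T) * (Real.log Y ^ i * (9 * C₀ * x ^ 6)) := by positivity
    calc _ ≤ (Real.log Y ^ j * L4) * ((2 * T) * (Real.log Y ^ i * (9 * C₀ * x ^ 6))) :=
          mul_le_mul_of_nonneg_right (hSb j) hX
      _ = _ := by rw [pow_add, hTdef]; field_simp; ring
  have t3 : |c| * ((∑ k ∈ Icc 1 ⌊Y⌋₊, |b k - if k = 1 then c else 0| * ellp Y k ^ j) *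
      (1 * (Real.log Y ^ i * (3 * C₀ * sq)))) ≤ Real.log Y ^ (i + j) * (C₀ * (3 * CD * W * sq)) := by
    have hX : 0 ≤ 1 * (Real.log Y ^ i * (3 * C₀ * sq)) := by rw [one_mul]; exact mul_nonneg hLi hP3
    calc _ ≤ |c| * ((Real.log Y ^ j * W) * (1 * (Real.log Y ^ i * (3 * C₀ * sq)))) :=
          mul_le_mul_of_nonneg_left (mul_le_mul_of_nonneg_right (hSbt j) hX) (abs_nonneg c)
      _ ≤ CD * ((Real.log Y ^ j * W) * (1 * (Real.log Y ^ i * (3 * C₀ * sq)))) :=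
          mul_le_mul_of_nonneg_right hc' (mul_nonneg (mul_nonneg hLj hW0) hX)
      _ = _ := by rw [pow_add]; ring
  have t4 : |c| * ((∑ k ∈ Icc 1 ⌊Y⌋₊, |(if k = 1 then (1 : ℝ) else 0)| * ellp Y k ^ i) *
      ((2 * T) * (Real.log Y ^ j * (9 * C₀ * x ^ 6)))) ≤
      Real.log Y ^ (i + j) * (C₀ * (18 * CD ^ 2 * x ^ 6 / (1 + Real.log K₁) ^ 12)) := by
    rw [hSδ]
    have hX : 0 ≤ Real.log Y ^ i * ((2 * T) * (Real.log Y ^ j * (9 * C₀ * x ^ 6))) := by positivity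
    calc _ ≤ CD * (Real.log Y ^ i * ((2 * T) * (Real.log Y ^ j * (9 * C₀ * x ^ 6)))) :=
          mul_le_mul_of_nonneg_right hc' hX
      _ = _ := by rw [pow_add, hTdef]; field_simp; ring
  have t5 : c ^ 2 * Real.log Y ^ i * Real.log Y ^ j *
      |(∫ u₁ in Set.Ioi (0 : ℝ), ∫ u₂ in Set.Ioi (α / u₁),
        Real.exp (-(u₁ + u₂)) / (1 - Real.exp (-(u₁ + u₂))) ^ 2) - (Real.log (1 / α) / 2 + E₀₀)| ≤
      Real.log Y ^ (i + j) * (C₀ * (CD ^ 2 * (sq + x ^ 6 / (1 + Real.log K₁) ^ 12))) := by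
    have hc2 : c ^ 2 ≤ CD ^ 2 := by
      rw [← sq_abs]; exact pow_le_pow_left₀ (abs_nonneg c) hc' 2
    have hCD2 : 0 ≤ CD ^ 2 := pow_nonneg hCD0 2
    calc _ ≤ CD ^ 2 * Real.log Y ^ i * Real.log Y ^ j * (C₀ * (sq + x ^ 6 / (1 + Real.log K₁) ^ 12)) :=
          mul_le_mul (mul_le_mul_of_nonneg_right (mul_le_mul_of_nonneg_right hc2 hLi) hLj) hRα (abs_nonneg _)
            (mul_nonneg (mul_nonneg hCD2 hLi) hLj)
      _ = _ := by rw [pow_add]; ring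
  rw [hl1]
  have hsum := add_le_add (add_le_add (add_le_add t1 t2) (add_le_add t3 t4)) t5
  refine le_trans (le_of_eq ?_) (hsum.trans (le_of_eq ?_))
  · ring
  · rw [hCD]; field_simp; ring

end Summit.Parity.GeneralizedHardyLittlewood.Theorems.MomentsBeyondDiagonal.DiagCorner

end
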